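import Mathlib
import HarnessLib

/-!
# Feldman–Salmhofer–Trubowitz IV — Lemma 1 (the convex-surface lemma) — PROOF

J. Feldman, M. Salmhofer, E. Trubowitz, *An inversion theorem in Fermi surface theory*, Comm. Pure
Appl. Math. **53** (2000) 1350–1384 = arXiv:math-ph/0001031 [FeldmanSalmhoferTrubowitz2000]; render
`paper:arxiv-math-ph_0001031` (`lit read`), locators `p.N:Ln` = chunk `pNNNN.txt`, line `n` (NOT
printed pages; the stable locators are "Lemma 1", "§2.1", "Appendix: Proof of Lemma (convsurface)").
Companion (theorem side) of the frozen statement file `FermiRG/FSTInversion.lean`; optional DAG row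
`FSTinv.L1-3` (its L1 part) of the `gate-hubbard-kl` typer wave.  No `sorry`, no new named fact
(net fact debt 0); the two definitions of this file are a HYPOTHESIS STRUCTURE and the printed notion
"maximally separated points".

## The printed statement (§2.1, p.6:L29–57)

> **Lemma 1.** Let `0 < k ≤ K`. Let `S` be a `(d−1)`–dimensional `C²` convex surface in `ℝ^d` all of
> whose principal curvatures are between `k` and `K`. Let `c₁, c₂` be any two maximally separated
> points of `S`. That is, `c₁, c₂ ∈ S` with `‖c₁ − c₂‖ = max{‖p₁ − p₂‖ : p₁, p₂ ∈ S}`.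
> Set `c = ½(c₁ + c₂)`. Then, for every `p ∈ S`, `1/K ≤ ‖p − c‖ ≤ 1/k`, and the angle `θ(p)` between
> `p − c` and the outward pointing normal vector `n(p)` to `S` at `p` obeys `cos(θ(p)) ≥ k/K`.
> If, in addition, `−p ∈ S` for every `p ∈ S`, then `c` is the origin.

Printed proof: Appendix "Proof of Lemma (convsurface)" (p.19:L1–p.20:L34): the angle bound follows from
the radius bounds because "the sphere of radius `1/K` centered on `c` … is inside `S`" and `S` lies on
one side of each tangent plane (p.19:L3–17); the radius bounds are "a variant of a classical result.
See, for example, §24 of [B]" ([B] = W. Blaschke, *Kreis und Kugel*, Leipzig 1916), proved there with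
the parallel surfaces `S̃ = {p − n(p)/L}` (`L > K`, resp. `ℓ < k`); the symmetric clause uses
"`n(c₁) = (c₁ − c₂)/‖c₁ − c₂‖ = −n(c₂)`" (p.19:L56–60) and injectivity of the Gauss map (p.20:L33–34).

## How the hypothesis is typed — the one modelling decision of this file (read this first)

"`S` is a `C²` convex surface all of whose principal curvatures are between `k` and `K`" enters through
its classical GLOBAL equivalent for closed `C²` convex hypersurfaces, BLASCHKE'S ROLLING THEOREM
([B] §24 — the source's own pointer, p.19:L19–20; a modern statement is "Blaschke's Rolling Theorem"
in K. Drach, arXiv:1402.2691 §1: (A) normal curvatures `≥ λ` everywhere ⇒ `∂D` lies in the closed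
ball bounded by the `λ`-sphere touching `∂D` from inside at any point; (B) normal curvatures `≤ λ`
everywhere ⇒ that `λ`-sphere lies in `D`): the surface is typed as `S = frontier B` for a compact
convex set `B` (the closed region bounded by `S`) of a real inner-product space `V` of any dimension,
together with a unit vector field `n` on `S` such that, for every `p ∈ S`,

  `closedBall (p − K⁻¹ • n p) K⁻¹ ⊆ B ⊆ closedBall (p − k⁻¹ • n p) k⁻¹`

(`RollingConvexBody k K B n` below — a `Prop`-valued hypothesis structure: NOTHING is asserted and no
named fact is minted).  The outer ball makes `n p` an outward SUPPORTING normal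
(`RollingConvexBody.inner_sub_le`), and the inner ball singles out THE normal
(`RollingConvexBody.normal_unique`), so `n` is the printed "outward pointing normal vector `n(p)`".
From these hypotheses ALL FOUR printed conclusions are PROVED (`FST4.lemma1`).  What is NOT
formalised here is the differential-geometric implication "principal curvatures in `[k, K]` ⇒ the two
rolling balls" (Blaschke) — `TODO(general form)`: it needs second fundamental forms of hypersurfaces,
which Mathlib does not have; the `d = 2` case (support-function parametrisation of a `C²` convex curve,
radius of curvature `h + h″ ∈ [1/K, 1/k]`) is the subject of a separate companion.

## Proof map (ours; elementary convex geometry in place of the parallel surfaces of the Appendix)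

* `exists_mem_frontier_on_ray` (device): from `x ∈ B` along `v ≠ 0` the LAST point of the compact set
  `B` on the ray is a frontier point — gives `B ⊆ closedBall c₁ ‖c₁ − c₂‖` for a maximally separated
  pair (`norm_sub_le_diam`), `‖c₁ − c₂‖ ≥ 2/K` (`two_mul_inv_le_diam`) and `B = −B` from `S = −S`
  (`neg_mem`).
* `normal_snd_eq` / `normal_fst_eq`: `n(c₂) = −u`, `n(c₁) = u`, `u = (c₁ − c₂)/‖c₁ − c₂‖` — the print's
  "as the chord `c₁ − c₂` is of maximal length, it must be parallel to both `n(c₁)` and `n(c₂)`"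
  (p.19:L56–58), here from the inner ball at `c₂` inside `closedBall c₁ ‖c₁ − c₂‖`.
* `norm_sub_midpoint_le` (`‖p − c‖ ≤ 1/k`, even for all `p ∈ B`): `B` lies in the two outer balls at
  `c₁, c₂`, whose centres are symmetric about `c`; parallelogram law.
* `closedBall_midpoint_subset` (`closedBall c K⁻¹ ⊆ B`, the print's "sphere of radius `1/K` centered
  on `c` … inside `S`", p.19:L6–7): `c` is the midpoint of the centres of the two inner balls at
  `c₁, c₂`; convexity.  Hence `inv_le_norm_sub_midpoint` (`1/K ≤ ‖p − c‖` on `S = frontier B`).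
* `inv_le_inner_sub_midpoint` / `cos_angle_ge` (`cos θ(p) ≥ k/K`): exactly the printed tangent-plane
  argument p.19:L3–17 (`c + K⁻¹ n(p) ∈ B` lies in the supporting half-space at `p`).
* `midpoint_eq_zero` (symmetric clause): `n(−p) = −n(p)` (`normal_neg`, via `B = −B` and uniqueness of
  the rolling normal) and Gauss-map injectivity from the outer balls (`eq_of_normal_eq`), then the
  print's last sentence (p.20:L33–34) verbatim.

Typer lint: no `instance`, no `notation`, no attribute changes; imports Mathlib + HarnessLib only.
-/

noncomputable section

open Metric Set
open scoped InnerProductSpace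

namespace Literature.MathematicalPhysics.QuantumLattice.FermiRG

namespace FST4

variable {V : Type*} [NormedAddCommGroup V]

section InnerProduct

variable [InnerProductSpace ℝ V]

/-! ### The hypothesis structure -/

/-- **The surface class of FST IV Lemma 1, rolling-ball form.**  `RollingConvexBody k K B n`: `0 < k ≤ K`;
`B ⊆ V` is compact and convex (the closed region bounded by the surface `S = frontier B`); `n` is a
unit vector field on `S`; and at every `p ∈ S` the ball of radius `1/K` touching `S` at `p` from the
side `−n(p)` lies in `B` while `B` lies in the ball of radius `1/k` touching `S` at `p` from the same
side: `closedBall (p − K⁻¹ • n p) K⁻¹ ⊆ B ⊆ closedBall (p − k⁻¹ • n p) k⁻¹`.  For a `C²` closed convex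
hypersurface these two inclusions are equivalent to "all principal curvatures are between `k` and `K`"
(Blaschke's rolling theorem, [B] §24 as cited by the source p.19:L19–20; Drach arXiv:1402.2691 §1
(A)/(B)); that implication is not formalised here (module docstring).  Hypothesis structure only —
nothing is asserted.
[cite: FeldmanSalmhoferTrubowitz2000, Lemma 1 (hypotheses) §2.1 p.6:L29-33; App. p.19:L19-20] -/
structure RollingConvexBody (k K : ℝ) (B : Set V) (n : V → V) : Prop where
  k_pos : 0 < k
  k_le : k ≤ K
  isCompact : IsCompact B
  convex : Convex ℝ B
  norm_normal : ∀ p ∈ frontier B, ‖n p‖ = 1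
  inner_ball : ∀ p ∈ frontier B, closedBall (p - K⁻¹ • n p) K⁻¹ ⊆ B
  outer_ball : ∀ p ∈ frontier B, B ⊆ closedBall (p - k⁻¹ • n p) k⁻¹

end InnerProduct

/-! ### The printed notion of maximally separated points (norm only) -/

/-- **Maximally separated points** (FST IV Lemma 1, p.6:L33–40): `c₁, c₂ ∈ S` with
`‖c₁ − c₂‖ = max{‖p₁ − p₂‖ : p₁, p₂ ∈ S}`, typed as: both points lie in `S` and no pair of points of `S`
is farther apart.
[cite: FeldmanSalmhoferTrubowitz2000, Lemma 1 §2.1 p.6:L33-40] -/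
def IsMaxSeparated (S : Set V) (c₁ c₂ : V) : Prop :=
  c₁ ∈ S ∧ c₂ ∈ S ∧ ∀ p₁ ∈ S, ∀ p₂ ∈ S, ‖p₁ - p₂‖ ≤ ‖c₁ - c₂‖

/-- Maximal separation is symmetric in the two points.
[cite: FeldmanSalmhoferTrubowitz2000, Lemma 1 §2.1 p.6:L33-40] -/
theorem IsMaxSeparated.symm {S : Set V} {c₁ c₂ : V} (h : IsMaxSeparated S c₁ c₂) :
    IsMaxSeparated S c₂ c₁ := by
  refine ⟨h.2.1, h.1, fun p₁ hp₁ p₂ hp₂ => ?_⟩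
  rw [norm_sub_rev c₂ c₁]
  exact h.2.2 p₁ hp₁ p₂ hp₂

/-- The frontier of a compact set is compact (a closed subset of the set). Proof device.
[cite: FeldmanSalmhoferTrubowitz2000, Lemma 1 §2.1 p.6:L29-40 (setting)] -/
theorem isCompact_frontier_of_isCompact {B : Set V} (hB : IsCompact B) : IsCompact (frontier B) :=
  hB.of_isClosed_subset isClosed_frontier
    (frontier_subset_closure.trans hB.isClosed.closure_subset)

/-- Non-vacuity of "maximally separated": a compact set with nonempty frontier HAS a maximally
separated pair of frontier points (the continuous function `‖p₁ − p₂‖` attains its maximum on the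
compact set `S × S`).
[cite: FeldmanSalmhoferTrubowitz2000, Lemma 1 §2.1 p.6:L33-40] -/
theorem exists_isMaxSeparated {B : Set V} (hB : IsCompact B) (hne : (frontier B).Nonempty) :
    ∃ c₁ c₂ : V, IsMaxSeparated (frontier B) c₁ c₂ := by
  have hS : IsCompact (frontier B) := isCompact_frontier_of_isCompact hB
  have hSS : IsCompact (frontier B ×ˢ frontier B) := hS.prod hS
  have hcont : Continuous fun q : V × V => ‖q.1 - q.2‖ :=
    (continuous_fst.sub continuous_snd).norm
  obtain ⟨q, hq, hmax⟩ := hSS.exists_isMaxOn (hne.prod hne) hcont.continuousOn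
  refine ⟨q.1, q.2, (mem_prod.1 hq).1, (mem_prod.1 hq).2, fun p₁ hp₁ p₂ hp₂ => ?_⟩
  exact (isMaxOn_iff.1 hmax) (p₁, p₂) (mk_mem_prod hp₁ hp₂)

/-! ### A ray lemma (proof device) -/

section Ray

variable [NormedSpace ℝ V]

/-- **Ray lemma** (proof device replacing the Appendix's parallel surfaces): in a compact set `B`, from
a point `x ∈ B` along a direction `v ≠ 0`, the last point `x + t • v` (`t ≥ 0`) of `B` on the ray exists
and lies on `frontier B`; every `x + s • v ∈ B` with `s ≥ 0` has `s ≤ t`.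
[cite: FeldmanSalmhoferTrubowitz2000, Lemma 1 (proof device) App. p.19:L1-p.20:L34] -/
theorem exists_mem_frontier_on_ray {B : Set V} (hB : IsCompact B) {x v : V} (hx : x ∈ B)
    (hv : v ≠ 0) :
    ∃ t : ℝ, 0 ≤ t ∧ x + t • v ∈ frontier B ∧ ∀ s : ℝ, 0 ≤ s → x + s • v ∈ B → s ≤ t := by
  have hvpos : 0 < ‖v‖ := norm_pos_iff.2 hv
  set T : Set ℝ := {t | 0 ≤ t ∧ x + t • v ∈ B} with hT
  have hT0 : (0 : ℝ) ∈ T := ⟨le_rfl, by simpa using hx⟩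
  have hTne : T.Nonempty := ⟨0, hT0⟩
  have hcont : Continuous fun t : ℝ => x + t • v :=
    continuous_const.add (continuous_id.smul continuous_const)
  have hTclosed : IsClosed T := by
    have hTeq : T = Ici (0 : ℝ) ∩ (fun t : ℝ => x + t • v) ⁻¹' B := by
      ext t
      simp [hT]
    rw [hTeq]
    exact isClosed_Ici.inter (hB.isClosed.preimage hcont)
  obtain ⟨R, hR⟩ := hB.isBounded.subset_closedBall (0 : V)
  -- every `t ∈ T` is at most `M := (R + ‖x‖) / ‖v‖`
  have hbound : ∀ t ∈ T, t ≤ (R + ‖x‖) / ‖v‖ := by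
    intro t ht
    rw [le_div_iff₀ hvpos]
    have hmem := hR ht.2
    rw [mem_closedBall, dist_zero_right] at hmem
    have h1 : ‖t • v‖ ≤ ‖x + t • v‖ + ‖x‖ := by
      have h2 := norm_sub_le (x + t • v) x
      rwa [add_sub_cancel_left] at h2
    rw [norm_smul, Real.norm_of_nonneg ht.1] at h1
    linarith
  have hTcpt : IsCompact T :=
    (isCompact_Icc : IsCompact (Icc (0 : ℝ) ((R + ‖x‖) / ‖v‖))).of_isClosed_subset hTclosed
      (fun t ht => ⟨ht.1, hbound t ht⟩)
  have hTbdd : BddAbove T := hTcpt.bddAbove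
  have hsup : sSup T ∈ T := hTcpt.sSup_mem hTne
  refine ⟨sSup T, hsup.1, ?_, fun s hs hsB => le_csSup hTbdd ⟨hs, hsB⟩⟩
  refine ⟨subset_closure hsup.2, fun hint => ?_⟩
  -- if the last point were interior, the ray would continue inside `B`
  obtain ⟨ε, hε, hball⟩ := Metric.mem_nhds_iff.1 (mem_interior_iff_mem_nhds.1 hint)
  have hstep : 0 < ε / (2 * ‖v‖) := by positivity
  have hmem : x + (sSup T + ε / (2 * ‖v‖)) • v ∈ B := by
    apply hball
    rw [mem_ball, dist_eq_norm]
    have hcalc : x + (sSup T + ε / (2 * ‖v‖)) • v - (x + sSup T • v) = (ε / (2 * ‖v‖)) • v := by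
      rw [add_smul]
      abel
    rw [hcalc, norm_smul, Real.norm_of_nonneg hstep.le]
    have : ε / (2 * ‖v‖) * ‖v‖ = ε / 2 := by
      field_simp
    rw [this]
    linarith
  have hle : sSup T + ε / (2 * ‖v‖) ≤ sSup T :=
    le_csSup hTbdd ⟨by linarith [hsup.1], hmem⟩
  linarith

/-- Consequence of the ray lemma: for `x, y` in a compact set `B` with nonempty frontier there is a
frontier point at least as far from `x` as `y` is. Proof device.
[cite: FeldmanSalmhoferTrubowitz2000, Lemma 1 (proof device) App. p.19:L1-p.20:L34] -/
theorem exists_frontier_norm_sub_ge {B : Set V} (hB : IsCompact B) {x y : V} (hx : x ∈ B)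
    (hy : y ∈ B) (hS : (frontier B).Nonempty) :
    ∃ z ∈ frontier B, ‖y - x‖ ≤ ‖z - x‖ := by
  by_cases hxy : y = x
  · obtain ⟨z, hz⟩ := hS
    exact ⟨z, hz, by simp [hxy]⟩
  have hv : y - x ≠ 0 := sub_ne_zero.2 hxy
  obtain ⟨t, ht0, htfr, htmax⟩ := exists_mem_frontier_on_ray hB hx hv
  have h1 : (1 : ℝ) ≤ t := htmax 1 zero_le_one (by simpa using hy)
  refine ⟨x + t • (y - x), htfr, ?_⟩
  rw [add_sub_cancel_left, norm_smul, Real.norm_of_nonneg ht0]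
  exact le_mul_of_one_le_left (norm_nonneg _) h1

end Ray

/-! ### Lemma 1 -/

section Lemma1

variable [InnerProductSpace ℝ V] {k K : ℝ} {B : Set V} {n : V → V} {c₁ c₂ : V}

namespace RollingConvexBody

/-- `0 < K`. [cite: FeldmanSalmhoferTrubowitz2000, Lemma 1 §2.1 p.6:L29] -/
theorem K_pos (h : RollingConvexBody k K B n) : 0 < K := h.k_pos.trans_le h.k_le

/-- `S = frontier B ⊆ B` (`B` is closed). [cite: FeldmanSalmhoferTrubowitz2000, Lemma 1 §2.1 p.6:L29-33] -/
theorem frontier_subset (h : RollingConvexBody k K B n) : frontier B ⊆ B :=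
  frontier_subset_closure.trans h.isCompact.isClosed.closure_subset

/-- **The outer ball makes `n p` an outward supporting normal, quantitatively**: for `p ∈ S` and
`y ∈ B`, `⟪y − p, n p⟫ ≤ −(k/2)‖y − p‖²` ("since `S` is convex it lies on one side of `T`", App.
p.19:L5–6, in the strong form the curvature lower bound gives).
[cite: FeldmanSalmhoferTrubowitz2000, Lemma 1 (proof) App. p.19:L3-17] -/
theorem inner_sub_le (h : RollingConvexBody k K B n) {p y : V} (hp : p ∈ frontier B) (hy : y ∈ B) :
    ⟪y - p, n p⟫_ℝ ≤ -(k / 2) * ‖y - p‖ ^ 2 := by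
  have hk := h.k_pos
  have hmem := h.outer_ball p hp hy
  rw [mem_closedBall, dist_eq_norm] at hmem
  have h1 : y - (p - k⁻¹ • n p) = (y - p) + k⁻¹ • n p := by abel
  rw [h1] at hmem
  have h2 : ‖(y - p) + k⁻¹ • n p‖ ^ 2 ≤ k⁻¹ ^ 2 := pow_le_pow_left₀ (norm_nonneg _) hmem 2
  rw [norm_add_sq_real, real_inner_smul_right, norm_smul, h.norm_normal p hp,
    Real.norm_of_nonneg (inv_nonneg.2 hk.le), mul_one] at h2
  have h3 : ‖y - p‖ ^ 2 + 2 * k⁻¹ * ⟪y - p, n p⟫_ℝ ≤ 0 := by linarith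
  have h4 : k / 2 * (‖y - p‖ ^ 2 + 2 * k⁻¹ * ⟪y - p, n p⟫_ℝ) ≤ 0 :=
    mul_nonpos_of_nonneg_of_nonpos (by positivity) h3
  have h5 : k / 2 * (‖y - p‖ ^ 2 + 2 * k⁻¹ * ⟪y - p, n p⟫_ℝ)
      = k / 2 * ‖y - p‖ ^ 2 + ⟪y - p, n p⟫_ℝ := by
    field_simp
  rw [h5] at h4
  linarith

/-- The supporting half-space: for `p ∈ S` and `y ∈ B`, `⟪y − p, n p⟫ ≤ 0`.
[cite: FeldmanSalmhoferTrubowitz2000, Lemma 1 (proof) App. p.19:L5-6] -/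
theorem inner_sub_nonpos (h : RollingConvexBody k K B n) {p y : V} (hp : p ∈ frontier B)
    (hy : y ∈ B) : ⟪y - p, n p⟫_ℝ ≤ 0 := by
  have h1 := h.inner_sub_le hp hy
  have h2 : -(k / 2) * ‖y - p‖ ^ 2 ≤ 0 :=
    mul_nonpos_of_nonpos_of_nonneg (by linarith [h.k_pos]) (sq_nonneg _)
  exact h1.trans h2

/-- `B` lies in the closed ball of radius `‖c₁ − c₂‖` about `c₁` when `c₁, c₂` are maximally separated
frontier points (ray lemma + maximality).
[cite: FeldmanSalmhoferTrubowitz2000, Lemma 1 (proof) App. p.19:L56-58] -/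
theorem norm_sub_le_diam (h : RollingConvexBody k K B n) (hc : IsMaxSeparated (frontier B) c₁ c₂)
    {y : V} (hy : y ∈ B) : ‖y - c₁‖ ≤ ‖c₁ - c₂‖ := by
  obtain ⟨z, hz, hyz⟩ :=
    exists_frontier_norm_sub_ge h.isCompact (h.frontier_subset hc.1) hy ⟨c₁, hc.1⟩
  have hz' : ‖z - c₁‖ ≤ ‖c₁ - c₂‖ := hc.2.2 z hz c₁ hc.1
  exact hyz.trans hz'

/-- The diameter of `S` is at least `2/K` (the inner ball at `c₁` has diameter `2/K`).
[cite: FeldmanSalmhoferTrubowitz2000, Lemma 1 (proof) App. p.19:L18-p.20:L10] -/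
theorem two_mul_inv_le_diam (h : RollingConvexBody k K B n)
    (hc : IsMaxSeparated (frontier B) c₁ c₂) : 2 * K⁻¹ ≤ ‖c₁ - c₂‖ := by
  have hK := h.K_pos
  have hw : c₁ - (2 * K⁻¹) • n c₁ ∈ B := by
    apply h.inner_ball c₁ hc.1
    rw [mem_closedBall, dist_eq_norm]
    have h1 : c₁ - (2 * K⁻¹) • n c₁ - (c₁ - K⁻¹ • n c₁) = (-K⁻¹) • n c₁ := by
      module
    rw [h1, norm_smul, h.norm_normal c₁ hc.1, mul_one, norm_neg,
      Real.norm_of_nonneg (inv_nonneg.2 hK.le)]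
  have h2 := h.norm_sub_le_diam hc hw
  rwa [sub_sub_cancel_left, norm_neg, norm_smul, h.norm_normal c₁ hc.1, mul_one,
    Real.norm_of_nonneg (by positivity : (0 : ℝ) ≤ 2 * K⁻¹)] at h2

/-- Maximally separated frontier points are distinct; the diameter is positive.
[cite: FeldmanSalmhoferTrubowitz2000, Lemma 1 §2.1 p.6:L33-40] -/
theorem diam_pos (h : RollingConvexBody k K B n) (hc : IsMaxSeparated (frontier B) c₁ c₂) :
    0 < ‖c₁ - c₂‖ :=
  lt_of_lt_of_le (by have := h.K_pos; positivity) (h.two_mul_inv_le_diam hc)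

/-- **The normal at the second endpoint of a diameter**: `n(c₂) = −(c₁ − c₂)/‖c₁ − c₂‖` (print:
"`n(c₁) = (c₁ − c₂)/‖c₁ − c₂‖ = −n(c₂)`", App. p.19:L56–60; here from the inner ball at `c₂` lying in
`closedBall c₁ ‖c₁ − c₂‖`).
[cite: FeldmanSalmhoferTrubowitz2000, Lemma 1 (proof) App. p.19:L56-60] -/
theorem normal_snd_eq (h : RollingConvexBody k K B n) (hc : IsMaxSeparated (frontier B) c₁ c₂) :
    n c₂ = -(‖c₁ - c₂‖⁻¹ • (c₁ - c₂)) := by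
  have hK := h.K_pos
  have hDpos' : 0 < ‖c₁ - c₂‖ := h.diam_pos hc
  obtain ⟨D, hD⟩ : ∃ D : ℝ, D = ‖c₁ - c₂‖ := ⟨_, rfl⟩
  obtain ⟨u, hu⟩ : ∃ u : V, u = D⁻¹ • (c₁ - c₂) := ⟨_, rfl⟩
  rw [← hD, ← hu]
  have hDpos : 0 < D := by rwa [← hD] at hDpos'
  have hu1 : ‖u‖ = 1 := by
    rw [hu, norm_smul, Real.norm_of_nonneg (inv_nonneg.2 hDpos.le), ← hD, inv_mul_cancel₀ hDpos.ne']
  have hm1 : ‖n c₂‖ = 1 := h.norm_normal c₂ hc.2.1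
  -- the point `y = c₂ − K⁻¹ n(c₂) − K⁻¹ u` of the inner ball at `c₂` lies in `B`, hence within `D` of `c₁`
  have hy : c₂ - K⁻¹ • n c₂ - K⁻¹ • u ∈ B := by
    apply h.inner_ball c₂ hc.2.1
    rw [mem_closedBall, dist_eq_norm]
    have h1 : c₂ - K⁻¹ • n c₂ - K⁻¹ • u - (c₂ - K⁻¹ • n c₂) = -(K⁻¹ • u) := by abel
    rw [h1, norm_neg, norm_smul, Real.norm_of_nonneg (inv_nonneg.2 hK.le), hu1, mul_one]
  have hyD : ‖c₂ - K⁻¹ • n c₂ - K⁻¹ • u - c₁‖ ≤ D := by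
    rw [hD]
    exact h.norm_sub_le_diam hc hy
  have hc21 : c₂ - c₁ = -(D • u) := by
    rw [hu, smul_smul, mul_inv_cancel₀ hDpos.ne', one_smul]
    abel
  have hexpr : c₂ - K⁻¹ • n c₂ - K⁻¹ • u - c₁ = -((D + K⁻¹) • u + K⁻¹ • n c₂) := by
    have h1 : c₂ - K⁻¹ • n c₂ - K⁻¹ • u - c₁ = (c₂ - c₁) - K⁻¹ • n c₂ - K⁻¹ • u := by abel
    rw [h1, hc21, add_smul]
    abel
  rw [hexpr, norm_neg] at hyD
  have hsq : ‖(D + K⁻¹) • u + K⁻¹ • n c₂‖ ^ 2 ≤ D ^ 2 := pow_le_pow_left₀ (norm_nonneg _) hyD 2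
  rw [norm_add_sq_real, norm_smul, norm_smul, hu1, hm1, mul_one, mul_one,
    Real.norm_of_nonneg (by positivity : (0 : ℝ) ≤ D + K⁻¹),
    Real.norm_of_nonneg (inv_nonneg.2 hK.le), real_inner_smul_left, real_inner_smul_right] at hsq
  -- `hsq : (D + K⁻¹)² + 2 (D + K⁻¹) K⁻¹ ⟪u, n c₂⟫ + K⁻² ≤ D²`, i.e. `2 K⁻¹ (D + K⁻¹) (1 + ⟪u, n c₂⟫) ≤ 0`
  have key : 1 + ⟪u, n c₂⟫_ℝ ≤ 0 := by
    have hpos : 0 < 2 * K⁻¹ * (D + K⁻¹) := by positivity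
    have h1 : 2 * K⁻¹ * (D + K⁻¹) * (1 + ⟪u, n c₂⟫_ℝ) ≤ 2 * K⁻¹ * (D + K⁻¹) * 0 := by
      nlinarith [hsq]
    exact le_of_mul_le_mul_left h1 hpos
  have h0 : ‖u + n c₂‖ ^ 2 ≤ 0 := by
    rw [norm_add_sq_real, hu1, hm1]
    linarith
  have hum : u + n c₂ = 0 := by
    have h1 : ‖u + n c₂‖ ^ 2 = 0 := le_antisymm h0 (sq_nonneg _)
    exact norm_eq_zero.1 (pow_eq_zero_iff two_ne_zero |>.1 h1)
  exact eq_neg_of_add_eq_zero_right hum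

/-- **The normal at the first endpoint of a diameter**: `n(c₁) = (c₁ − c₂)/‖c₁ − c₂‖`
(App. p.19:L56–60).
[cite: FeldmanSalmhoferTrubowitz2000, Lemma 1 (proof) App. p.19:L56-60] -/
theorem normal_fst_eq (h : RollingConvexBody k K B n) (hc : IsMaxSeparated (frontier B) c₁ c₂) :
    n c₁ = ‖c₁ - c₂‖⁻¹ • (c₁ - c₂) := by
  have h1 := h.normal_snd_eq hc.symm
  rw [norm_sub_rev c₂ c₁, ← neg_sub c₁ c₂, smul_neg, neg_neg] at h1
  exact h1

/-- **`‖p − c‖ ≤ 1/k`** for every `p ∈ B` (in particular every `p ∈ S`), `c = ½(c₁ + c₂)`: `B` lies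
in the two outer balls at `c₁` and `c₂`, whose centres `c₁ − u/k`, `c₂ + u/k` are symmetric about
`c`; parallelogram law.  (Print: conclusion `‖p − c‖ ≤ 1/k` of Lemma 1, proved in App. p.20:L12–31 via
the parallel surface at distance `1/ℓ`, `ℓ < k`.)
[cite: FeldmanSalmhoferTrubowitz2000, Lemma 1 §2.1 p.6:L42-45; App. p.20:L12-31] -/
theorem norm_sub_midpoint_le (h : RollingConvexBody k K B n)
    (hc : IsMaxSeparated (frontier B) c₁ c₂) {p : V} (hp : p ∈ B) :
    ‖p - midpoint ℝ c₁ c₂‖ ≤ k⁻¹ := by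
  have hk := h.k_pos
  obtain ⟨u, hu⟩ : ∃ u : V, u = ‖c₁ - c₂‖⁻¹ • (c₁ - c₂) := ⟨_, rfl⟩
  have hn1 : n c₁ = u := hu ▸ h.normal_fst_eq hc
  have hn2 : n c₂ = -u := hu ▸ h.normal_snd_eq hc
  have h1 := h.outer_ball c₁ hc.1 hp
  have h2 := h.outer_ball c₂ hc.2.1 hp
  rw [mem_closedBall, dist_eq_norm, hn1] at h1
  rw [mem_closedBall, dist_eq_norm, hn2, smul_neg, sub_neg_eq_add] at h2
  obtain ⟨y₁, hy₁⟩ : ∃ y₁ : V, y₁ = p - (c₁ - k⁻¹ • u) := ⟨_, rfl⟩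
  obtain ⟨y₂, hy₂⟩ : ∃ y₂ : V, y₂ = p - (c₂ + k⁻¹ • u) := ⟨_, rfl⟩
  rw [← hy₁] at h1
  rw [← hy₂] at h2
  have hsum : y₁ + y₂ = (2 : ℝ) • (p - midpoint ℝ c₁ c₂) := by
    rw [hy₁, hy₂, midpoint_eq_smul_add, invOf_eq_inv]
    module
  have hpar := parallelogram_law_with_norm ℝ y₁ y₂
  have hb1 : ‖y₁‖ * ‖y₁‖ ≤ k⁻¹ * k⁻¹ := mul_self_le_mul_self (norm_nonneg _) h1
  have hb2 : ‖y₂‖ * ‖y₂‖ ≤ k⁻¹ * k⁻¹ := mul_self_le_mul_self (norm_nonneg _) h2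
  have hs : ‖y₁ + y₂‖ * ‖y₁ + y₂‖ ≤ 4 * (k⁻¹ * k⁻¹) := by
    nlinarith [mul_self_nonneg ‖y₁ - y₂‖]
  rw [hsum, norm_smul, Real.norm_of_nonneg (by norm_num : (0 : ℝ) ≤ 2)] at hs
  have hsq : ‖p - midpoint ℝ c₁ c₂‖ ^ 2 ≤ k⁻¹ ^ 2 := by nlinarith
  exact (pow_le_pow_iff_left₀ (norm_nonneg _) (inv_nonneg.2 hk.le) two_ne_zero).1 hsq

/-- **The ball of radius `1/K` about `c` lies in `B`** ("the sphere of radius `1/K` centered on `c`,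
which by (convradius) is inside `S`", App. p.19:L6–7): `c` is the midpoint of the centres `c₁ − u/K`,
`c₂ + u/K` of the two inner balls; convexity of `B`.
[cite: FeldmanSalmhoferTrubowitz2000, Lemma 1 (proof) App. p.19:L6-7; p.19:L18-p.20:L10] -/
theorem closedBall_midpoint_subset (h : RollingConvexBody k K B n)
    (hc : IsMaxSeparated (frontier B) c₁ c₂) : closedBall (midpoint ℝ c₁ c₂) K⁻¹ ⊆ B := by
  intro z hz
  rw [mem_closedBall, dist_eq_norm] at hz
  obtain ⟨u, hu⟩ : ∃ u : V, u = ‖c₁ - c₂‖⁻¹ • (c₁ - c₂) := ⟨_, rfl⟩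
  have hn1 : n c₁ = u := hu ▸ h.normal_fst_eq hc
  have hn2 : n c₂ = -u := hu ▸ h.normal_snd_eq hc
  obtain ⟨c, hcdef⟩ : ∃ c : V, c = midpoint ℝ c₁ c₂ := ⟨_, rfl⟩
  rw [← hcdef] at hz
  have hz1 : z + ((c₁ - K⁻¹ • u) - c) ∈ B := by
    apply h.inner_ball c₁ hc.1
    rw [mem_closedBall, dist_eq_norm, hn1]
    have h1 : z + ((c₁ - K⁻¹ • u) - c) - (c₁ - K⁻¹ • u) = z - c := by abel
    rw [h1]
    exact hz
  have hz2 : z + ((c₂ + K⁻¹ • u) - c) ∈ B := by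
    apply h.inner_ball c₂ hc.2.1
    rw [mem_closedBall, dist_eq_norm, hn2, smul_neg, sub_neg_eq_add]
    have h1 : z + ((c₂ + K⁻¹ • u) - c) - (c₂ + K⁻¹ • u) = z - c := by abel
    rw [h1]
    exact hz
  have hmid : (1 / 2 : ℝ) • (z + ((c₁ - K⁻¹ • u) - c)) + (1 / 2 : ℝ) • (z + ((c₂ + K⁻¹ • u) - c))
      = z := by
    rw [hcdef, midpoint_eq_smul_add, invOf_eq_inv]
    module
  have hmem := h.convex hz1 hz2 (by norm_num : (0 : ℝ) ≤ 1 / 2) (by norm_num : (0 : ℝ) ≤ 1 / 2)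
    (by norm_num)
  rwa [hmid] at hmem

/-- **`1/K ≤ ‖p − c‖`** for every `p ∈ S = frontier B` (conclusion of Lemma 1; App. p.19:L18–p.20:L10):
`closedBall c K⁻¹ ⊆ B`, so points of `B` closer than `1/K` to `c` are interior.
[cite: FeldmanSalmhoferTrubowitz2000, Lemma 1 §2.1 p.6:L42-45; App. p.19:L18-p.20:L10] -/
theorem inv_le_norm_sub_midpoint (h : RollingConvexBody k K B n)
    (hc : IsMaxSeparated (frontier B) c₁ c₂) {p : V} (hp : p ∈ frontier B) :
    K⁻¹ ≤ ‖p - midpoint ℝ c₁ c₂‖ := by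
  by_contra hlt
  rw [not_le] at hlt
  have hball : p ∈ ball (midpoint ℝ c₁ c₂) K⁻¹ := by
    rw [mem_ball, dist_eq_norm]
    exact hlt
  exact hp.2 (interior_mono (h.closedBall_midpoint_subset hc) (ball_subset_interior_closedBall hball))

/-- **`⟪p − c, n p⟫ ≥ 1/K`** for `p ∈ S` — the tangent-plane step of the printed proof (App. p.19:L3–10:
the ball of radius `1/K` about `c` lies in `B`, hence on the inner side of the tangent plane at `p`).
[cite: FeldmanSalmhoferTrubowitz2000, Lemma 1 (proof) App. p.19:L3-17] -/
theorem inv_le_inner_sub_midpoint (h : RollingConvexBody k K B n)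
    (hc : IsMaxSeparated (frontier B) c₁ c₂) {p : V} (hp : p ∈ frontier B) :
    K⁻¹ ≤ ⟪p - midpoint ℝ c₁ c₂, n p⟫_ℝ := by
  have hK := h.K_pos
  obtain ⟨c, hcdef⟩ : ∃ c : V, c = midpoint ℝ c₁ c₂ := ⟨_, rfl⟩
  rw [← hcdef]
  -- the point `c + K⁻¹ n(p)` of the ball `closedBall c K⁻¹ ⊆ B` lies in the supporting half-space at `p`
  have hy : c + K⁻¹ • n p ∈ B := by
    apply h.closedBall_midpoint_subset hc
    rw [← hcdef, mem_closedBall, dist_eq_norm, add_sub_cancel_left, norm_smul,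
      h.norm_normal p hp, mul_one, Real.norm_of_nonneg (inv_nonneg.2 hK.le)]
  have h1 := h.inner_sub_nonpos hp hy
  have hexp : ⟪c + K⁻¹ • n p - p, n p⟫_ℝ = -⟪p - c, n p⟫_ℝ + K⁻¹ := by
    have h2 : c + K⁻¹ • n p - p = -(p - c) + K⁻¹ • n p := by abel
    rw [h2, inner_add_left, inner_neg_left, real_inner_smul_left, real_inner_self_eq_norm_sq,
      h.norm_normal p hp]
    ring
  rw [hexp] at h1
  linarith

/-- **`(k/K)‖p − c‖ ≤ ⟪p − c, n p⟫`** for `p ∈ S`, i.e. `cos θ(p) ≥ k/K` in inner-product form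
(App. p.19:L8–10: "`cos θ(p) = ‖x − c‖/‖p − c‖ ≥ (1/K)/(1/k) = k/K`").
[cite: FeldmanSalmhoferTrubowitz2000, Lemma 1 §2.1 p.6:L46-52; App. p.19:L3-17] -/
theorem mul_norm_le_inner_sub_midpoint (h : RollingConvexBody k K B n)
    (hc : IsMaxSeparated (frontier B) c₁ c₂) {p : V} (hp : p ∈ frontier B) :
    k / K * ‖p - midpoint ℝ c₁ c₂‖ ≤ ⟪p - midpoint ℝ c₁ c₂, n p⟫_ℝ := by
  have hk := h.k_pos
  have hK := h.K_pos
  have h1 := h.norm_sub_midpoint_le hc (h.frontier_subset hp)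
  have h2 := h.inv_le_inner_sub_midpoint hc hp
  calc k / K * ‖p - midpoint ℝ c₁ c₂‖ ≤ k / K * k⁻¹ :=
        mul_le_mul_of_nonneg_left h1 (by positivity)
    _ = K⁻¹ := by field_simp
    _ ≤ _ := h2

/-- **`cos θ(p) ≥ k/K`**, with `θ(p)` the (unoriented) angle between `p − c` and the outward normal
`n(p)` (conclusion of Lemma 1, p.6:L46–52).
[cite: FeldmanSalmhoferTrubowitz2000, Lemma 1 §2.1 p.6:L46-52; App. p.19:L3-17] -/
theorem cos_angle_ge (h : RollingConvexBody k K B n) (hc : IsMaxSeparated (frontier B) c₁ c₂)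
    {p : V} (hp : p ∈ frontier B) :
    k / K ≤ Real.cos (InnerProductGeometry.angle (p - midpoint ℝ c₁ c₂) (n p)) := by
  have hK := h.K_pos
  rw [InnerProductGeometry.cos_angle, h.norm_normal p hp, mul_one]
  have hpos : 0 < ‖p - midpoint ℝ c₁ c₂‖ :=
    (inv_pos.2 hK).trans_le (h.inv_le_norm_sub_midpoint hc hp)
  rw [le_div_iff₀ hpos]
  exact h.mul_norm_le_inner_sub_midpoint hc hp

/-! #### The symmetric clause -/

/-- `B` is symmetric when its frontier is (`B` is recovered from `S` by segments: ray lemma).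
[cite: FeldmanSalmhoferTrubowitz2000, Lemma 1 (symmetric clause) §2.1 p.6:L54; App. p.20:L33-34] -/
theorem neg_mem (h : RollingConvexBody k K B n) (hS : ∀ p ∈ frontier B, -p ∈ frontier B)
    (hne : (frontier B).Nonempty) {y : V} (hy : y ∈ B) : -y ∈ B := by
  obtain ⟨q, hq⟩ := hne
  by_cases hyq : y = q
  · rw [hyq]
    exact h.frontier_subset (hS q hq)
  obtain ⟨t, ht0, htfr, -⟩ := exists_mem_frontier_on_ray h.isCompact hy (sub_ne_zero.2 hyq)
  have hq' : -q ∈ B := h.frontier_subset (hS q hq)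
  have hz' : -(y + t • (y - q)) ∈ B := h.frontier_subset (hS _ htfr)
  have ht1 : (0 : ℝ) < t + 1 := by linarith
  have ha : (0 : ℝ) ≤ t / (t + 1) := by positivity
  have hb : (0 : ℝ) ≤ 1 / (t + 1) := by positivity
  have hab : t / (t + 1) + 1 / (t + 1) = 1 := by
    field_simp
  have hmem := h.convex hq' hz' ha hb hab
  have hcomb : (t / (t + 1)) • (-q) + (1 / (t + 1)) • (-(y + t • (y - q))) = -y := by
    have h1 : (t / (t + 1)) • (-q) + (1 / (t + 1)) • (-(y + t • (y - q)))
        = -((1 / (t + 1) * (t + 1)) • y) := by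
      module
    have h2 : 1 / (t + 1) * (t + 1) = 1 := by
      field_simp
    rw [h1, h2, one_smul]
  rwa [hcomb] at hmem

/-- **Uniqueness of the rolling normal**: if a unit vector `v` at `p ∈ S` carries an inner ball,
`closedBall (p − K⁻¹ • v) K⁻¹ ⊆ B`, then `v = n p` (so `n` is THE outward normal of the print).
[cite: FeldmanSalmhoferTrubowitz2000, Lemma 1 (the normal `n(p)`) §2.1 p.6:L46-49] -/
theorem normal_unique (h : RollingConvexBody k K B n) {p v : V} (hp : p ∈ frontier B)
    (hv : ‖v‖ = 1) (hball : closedBall (p - K⁻¹ • v) K⁻¹ ⊆ B) : v = n p := by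
  have hK := h.K_pos
  have hy : p - K⁻¹ • v + K⁻¹ • n p ∈ B := by
    apply hball
    rw [mem_closedBall, dist_eq_norm, add_sub_cancel_left, norm_smul, h.norm_normal p hp, mul_one,
      Real.norm_of_nonneg (inv_nonneg.2 hK.le)]
  have h1 := h.inner_sub_nonpos hp hy
  have hexp : p - K⁻¹ • v + K⁻¹ • n p - p = K⁻¹ • (n p - v) := by
    rw [smul_sub]
    abel
  rw [hexp, real_inner_smul_left, inner_sub_left, real_inner_self_eq_norm_sq,
    h.norm_normal p hp, one_pow] at h1
  have h2 : 1 - ⟪v, n p⟫_ℝ ≤ 0 := by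
    have h3 : K⁻¹ * (1 - ⟪v, n p⟫_ℝ) ≤ K⁻¹ * 0 := by linarith
    exact le_of_mul_le_mul_left h3 (inv_pos.2 hK)
  have h0 : ‖v - n p‖ ^ 2 ≤ 0 := by
    rw [norm_sub_sq_real, hv, h.norm_normal p hp]
    linarith
  have h4 : ‖v - n p‖ ^ 2 = 0 := le_antisymm h0 (sq_nonneg _)
  exact sub_eq_zero.1 (norm_eq_zero.1 (pow_eq_zero_iff two_ne_zero |>.1 h4))

/-- On a symmetric surface the normal field is odd: `n(−p) = −n(p)` (used tacitly at App. p.20:L33–34).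
[cite: FeldmanSalmhoferTrubowitz2000, Lemma 1 (symmetric clause) App. p.20:L33-34] -/
theorem normal_neg (h : RollingConvexBody k K B n) (hS : ∀ p ∈ frontier B, -p ∈ frontier B)
    {p : V} (hp : p ∈ frontier B) : n (-p) = -n p := by
  symm
  apply h.normal_unique (hS p hp) (by rw [norm_neg]; exact h.norm_normal p hp)
  intro z hz
  rw [mem_closedBall, dist_eq_norm] at hz
  have hz' : -z ∈ B := by
    apply h.inner_ball p hp
    rw [mem_closedBall, dist_eq_norm]
    have h1 : -z - (p - K⁻¹ • n p) = -(z - (-p - K⁻¹ • -n p)) := by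
      rw [smul_neg]
      abel
    rw [h1, norm_neg]
    exact hz
  have h2 := h.neg_mem hS ⟨p, hp⟩ hz'
  rwa [neg_neg] at h2

/-- **Injectivity of the Gauss map** from the outer balls: two points of `S` with the same normal
coincide ("the Gauss map `p ∈ S ↦ n(p)` is bijective", App. p.19:L44–45).
[cite: FeldmanSalmhoferTrubowitz2000, Lemma 1 (proof) App. p.19:L44-45] -/
theorem eq_of_normal_eq (h : RollingConvexBody k K B n) {q₁ q₂ : V} (hq₁ : q₁ ∈ frontier B)
    (hq₂ : q₂ ∈ frontier B) (he : n q₁ = n q₂) : q₁ = q₂ := by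
  have hk := h.k_pos
  have h1 := h.inner_sub_le hq₁ (h.frontier_subset hq₂)
  have h2 := h.inner_sub_le hq₂ (h.frontier_subset hq₁)
  rw [← he, norm_sub_rev q₁ q₂] at h2
  have hsum : ⟪q₂ - q₁, n q₁⟫_ℝ + ⟪q₁ - q₂, n q₁⟫_ℝ = 0 := by
    rw [← inner_add_left]
    simp
  have h3 : ‖q₂ - q₁‖ ^ 2 ≤ 0 := by nlinarith
  have h4 : ‖q₂ - q₁‖ ^ 2 = 0 := le_antisymm h3 (sq_nonneg _)
  exact (sub_eq_zero.1 (norm_eq_zero.1 (pow_eq_zero_iff two_ne_zero |>.1 h4))).symm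

/-- **Symmetric clause of Lemma 1**: if `−p ∈ S` for every `p ∈ S`, then `c = ½(c₁ + c₂) = 0`
("`n(c₁) = −n(c₂)` implies that `c₁ = −c₂`", App. p.20:L33–34).
[cite: FeldmanSalmhoferTrubowitz2000, Lemma 1 §2.1 p.6:L54; App. p.20:L33-34] -/
theorem midpoint_eq_zero (h : RollingConvexBody k K B n) (hc : IsMaxSeparated (frontier B) c₁ c₂)
    (hS : ∀ p ∈ frontier B, -p ∈ frontier B) : midpoint ℝ c₁ c₂ = 0 := by
  have hn1 := h.normal_fst_eq hc
  have hn2 := h.normal_snd_eq hc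
  have hneg := h.normal_neg hS hc.1
  have h1 : n c₂ = n (-c₁) := by rw [hn2, hneg, hn1]
  have hc2 : c₂ = -c₁ := h.eq_of_normal_eq hc.2.1 (hS c₁ hc.1) h1
  rw [hc2, midpoint_self_neg]

end RollingConvexBody

/-- **FST IV Lemma 1** (the convex-surface lemma, §2.1 p.6:L29–57), for the rolling-ball surface class
`RollingConvexBody k K B n` (module docstring): if `c₁, c₂` are maximally separated points of
`S = frontier B` and `c = ½(c₁ + c₂)` (`midpoint ℝ c₁ c₂`), then for every `p ∈ S`:
`1/K ≤ ‖p − c‖ ≤ 1/k` and `cos θ(p) ≥ k/K`, `θ(p)` the angle between `p − c` and the outward normal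
`n(p)`; and if `−p ∈ S` for every `p ∈ S` then `c = 0`.
[cite: FeldmanSalmhoferTrubowitz2000, Lemma 1 §2.1 p.6:L29-57; App. p.19:L1-p.20:L34] -/
theorem lemma1 (h : RollingConvexBody k K B n) (hc : IsMaxSeparated (frontier B) c₁ c₂) :
    (∀ p ∈ frontier B,
        K⁻¹ ≤ ‖p - midpoint ℝ c₁ c₂‖ ∧ ‖p - midpoint ℝ c₁ c₂‖ ≤ k⁻¹ ∧
          k / K ≤ Real.cos (InnerProductGeometry.angle (p - midpoint ℝ c₁ c₂) (n p))) ∧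
      ((∀ p ∈ frontier B, -p ∈ frontier B) → midpoint ℝ c₁ c₂ = 0) :=
  ⟨fun _ hp => ⟨h.inv_le_norm_sub_midpoint hc hp, h.norm_sub_midpoint_le hc (h.frontier_subset hp),
    h.cos_angle_ge hc hp⟩, fun hS => h.midpoint_eq_zero hc hS⟩

/-- Lemma 1 packaged with the EXISTENCE of the maximally separated pair (non-vacuity of its binder):
a rolling-ball surface with nonempty frontier has a centre `c` with `1/K ≤ ‖p − c‖ ≤ 1/k` and
`⟪p − c, n p⟫ ≥ (k/K)‖p − c‖` for all `p ∈ S`.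
[cite: FeldmanSalmhoferTrubowitz2000, Lemma 1 §2.1 p.6:L29-57] -/
theorem lemma1_exists_center (h : RollingConvexBody k K B n) (hne : (frontier B).Nonempty) :
    ∃ c : V, ∀ p ∈ frontier B,
      K⁻¹ ≤ ‖p - c‖ ∧ ‖p - c‖ ≤ k⁻¹ ∧ k / K * ‖p - c‖ ≤ ⟪p - c, n p⟫_ℝ := by
  obtain ⟨c₁, c₂, hc⟩ := exists_isMaxSeparated h.isCompact hne
  exact ⟨midpoint ℝ c₁ c₂, fun p hp => ⟨h.inv_le_norm_sub_midpoint hc hp,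
    h.norm_sub_midpoint_le hc (h.frontier_subset hp), h.mul_norm_le_inner_sub_midpoint hc hp⟩⟩

end Lemma1

end FST4

end Literature.MathematicalPhysics.QuantumLattice.FermiRG
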